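import Summits.ResolutionOfSingularities.ResolutionOfSingularities.Theorems.EquisingularLiftEquisingularLiftNatCarrierDeltaRegular
import HarnessLib

/-!
# [OURS · L1 W4.5(b) · EL♮(3)] HSUB(ReachTC⁺) brick `inv_base`, part 2a (B3): the Δ-centre `St_τ(K) ⊔ E` read on a GIVEN chart
# presentation — stalks, support and regularity of the quotient stalk with the Δ-criterion on THAT chart only

Crux chain w45b (cell `res-hironaka`, slot W4.5(b)), working crux **EL♮** = stmt-ResolutionOfSingularities-20038, child **EL♮(3)** =
stmt-ResolutionOfSingularities-20148, route EquisingularLift, line `sections`, registered stub `stub_elnat_tcPlusPointResolution`;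
assembly HSUB(ReachTC⁺)₃ of res-L1-w45b-stub-1 (brick `inv_base`, CENTRED members: the Δ-criterion of T-ΔLIFT-CENTRED p523916 holds on
the charts `T₁ = 1`, `T₂ = 1` only). HONEST FRAMING: OURS; NOT a statement of any manuscript; AI-written, weaker than expert review.
No `sorry`; standard axioms. `--supports stmt-ResolutionOfSingularities-20148 --as helper`. DEF-FREE.

WHY. res-type-100's F2 (`exists_stalk_strictTransformIdeal_sup_comap`, p509910) and F3b (`isRegularLocalRing_stalk_quotient_carrierDelta`,
p513634) produce the chart index `j` EXISTENTIALLY and ask the Δ-criterion on every chart. For a CENTRED cone (regular on the charts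
`j ≠ 0` only, and on chart `0` off the vertex) one must read the stalk on a prescribed chart: this file gives the same conclusions
from a GIVEN presentation `(j, 𝔔, χ)` of `𝒪_{X',x'}` as the localisation of `R[I/c_j]` at `𝔔` (e.g. the one of T-PRES-CHART, or of
res-type-100's T-FRAME-AT for the downstairs blow-up), with the Δ-criterion required on the chart `j` alone.

WHAT.
* `stalkIdeal_carrierDelta_of_presentation` — F2 from a given presentation: `E_{x'} = (χ(c_j/1))`, `St_τ(K)_{x'} = (χ Φ(c/c_j))`,
  `C_{x'} = (χ Φ(c/c_j), χ(c_j/1))`, `x' ∈ supp C ↔ Φ(c/c_j) ∈ 𝔔`.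
* `isRegularLocalRing_stalk_quotient_carrierDelta_of_presentation` — F3b at the point from a given presentation and the Δ-criterion
  on chart `j`: `𝒪_{X',x'}/C_{x'}` is a regular local ring.

References: res-type-100 …NatCarrierDeltaStalks (p509910), …NatCarrierDeltaRegular (p513634), …NatConeChart (p508912) — the proofs
are theirs verbatim after the choice of the presentation.
-/

set_option linter.dupNamespace false -- mandated namespace `Summit.<Summit>.<Problem>` of this single-conjunct summit

noncomputable section

open CategoryTheory CategoryTheory.Limits AlgebraicGeometry TopologicalSpace IsLocalRing
open Literature.AlgebraicGeometry.Resolution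
open AlgebraicGeometry.Scheme.IdealSheafData

namespace Summit.ResolutionOfSingularities.ResolutionOfSingularities.Cruxes.EquisingularLiftNat.Sections

universe u

variable {X X' : Scheme.{u}} {τ : X' ⟶ X} {J : X.IdealSheafData}

set_option maxHeartbeats 400000 in -- the chart algebra `blowupAlgebra` is a subalgebra of a localisation: slow instance unification (cf. p509910)
/-- **F2 on a GIVEN chart presentation.** `τ : X' → X` (a blow-up along `J`; only the presentation is used), `X'` locally Noetherian, `τ x' = p ∈ supp J`, `J_p = (c)` with
`c` quasi-regular and `R/(c)` a domain, `K_p = (Φ(c))` for a form `Φ` of degree `d` with `Φ mod (c) ≠ 0`; and `(j, 𝔔, χ)` a presentation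
of `𝒪_{X',x'}` as the localisation of `R[I/c_j]` at the prime `𝔔` over `𝔪_R`, `χ` extending `τ^♯_{x'}`. Then `E_{x'} = (χ(c_j/1))`,
`St_τ(K)_{x'} = (χ Φ(c/c_j))`, `(St_τ(K) ⊔ E)_{x'} = (χ Φ(c/c_j)) + (χ(c_j/1))` and `x' ∈ supp (St_τ(K) ⊔ E) ↔ Φ(c/c_j) ∈ 𝔔`.
[cite: StacksProject, Tag 0804] -/
theorem stalkIdeal_carrierDelta_of_presentation [IsLocallyNoetherian X']
    (K : X.IdealSheafData) (x' : X') (p : X) (hp : τ x' = p) (hpJ : p ∈ (J.support : Set X)) {r : ℕ}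
    (c : Fin r → X.presheaf.stalk p) (hcJ : Ideal.span (Set.range c) = stalkIdeal J p)
    (hc : IsQuasiRegular c) [IsDomain (X.presheaf.stalk p ⧸ Ideal.span (Set.range c))]
    {d : ℕ} (Φ : MvPolynomial (Fin r) (X.presheaf.stalk p)) (hΦd : Φ.IsHomogeneous d)
    (hΦ : MvPolynomial.map (Ideal.Quotient.mk (Ideal.span (Set.range c))) Φ ≠ 0)
    (hK : stalkIdeal K p = Ideal.span {MvPolynomial.eval c Φ})
    (j : Fin r) (𝔔 : PrimeSpectrum (blowupAlgebra (Ideal.span (Set.range c)) (c j)))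
    (χ : blowupAlgebra (Ideal.span (Set.range c)) (c j) →+* X'.presheaf.stalk x')
    (hχ : ∀ a, χ (algebraMap _ _ a) = ((X.presheaf.stalkCongr (Inseparable.of_eq hp)).inv ≫ τ.stalkMap x').hom a)
    (hloc : @IsLocalization.AtPrime _ _ (X'.presheaf.stalk x') _ χ.toAlgebra 𝔔.asIdeal _)
    (h𝔔 : 𝔔.asIdeal.comap (algebraMap _ (blowupAlgebra (Ideal.span (Set.range c)) (c j))) = maximalIdeal (X.presheaf.stalk p)) :
    stalkIdeal (J.comap τ) x' = Ideal.span {χ (algebraMap _ (blowupAlgebra (Ideal.span (Set.range c)) (c j)) (c j))} ∧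
      stalkIdeal (strictTransformIdeal τ J K) x' = Ideal.span {χ (MvPolynomial.aeval (blowupAlgebra.frac c j) Φ)} ∧
      stalkIdeal (strictTransformIdeal τ J K ⊔ J.comap τ) x' =
        Ideal.span {χ (MvPolynomial.aeval (blowupAlgebra.frac c j) Φ)} ⊔
          Ideal.span {χ (algebraMap _ (blowupAlgebra (Ideal.span (Set.range c)) (c j)) (c j))} ∧
      (x' ∈ (strictTransformIdeal τ J K ⊔ J.comap τ).support ↔
        MvPolynomial.aeval (blowupAlgebra.frac c j) Φ ∈ 𝔔.asIdeal) := by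
  -- adapted from `exists_stalk_strictTransformIdeal_sup_comap` (…NatCarrierDeltaStalks, res-type-100): the presentation is an input
  subst hp
  letI := χ.toAlgebra
  haveI : IsLocalization.AtPrime (X'.presheaf.stalk x') 𝔔.asIdeal := hloc
  have hχ' : ∀ a, χ (algebraMap _ _ a) = (τ.stalkMap x').hom a := fun a => by
    rw [hχ a]; simp [TopCat.Presheaf.stalkCongr]
  have hstalkMap : (τ.stalkMap x').hom = χ.comp (algebraMap _ (blowupAlgebra (Ideal.span (Set.range c)) (c j))) :=
    RingHom.ext fun a => (hχ' a).symm
  have hE : stalkIdeal (J.comap τ) x' =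
      Ideal.span {χ (algebraMap _ (blowupAlgebra (Ideal.span (Set.range c)) (c j)) (c j))} := by
    rw [stalkIdeal_comap_eq_map_stalkMap, ← hcJ, hstalkMap, ← Ideal.map_map,
      map_blowupAlgebra_eq_span (Ideal.subset_span (Set.mem_range_self j)), Ideal.map_span, Set.image_singleton]
  have hΦj : MvPolynomial.map (Ideal.Quotient.mk (Ideal.span (Set.range c))) (dehomogenize j Φ) ≠ 0 := by
    rw [map_dehomogenize]
    exact dehomogenize_ne_zero_of_isHomogeneous j (hΦd.map _) hΦ
  have hSt : stalkIdeal (strictTransformIdeal τ J K) x' =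
      Ideal.span {χ (MvPolynomial.aeval (blowupAlgebra.frac c j) Φ)} := by
    rw [stalkIdeal_strictTransformIdeal, hE, hK, Ideal.map_span, Set.image_singleton, hstalkMap]
    exact iSup_colon_span_eval_eq_span_coneTransform_localization c j hc hΦd hΦj 𝔔.asIdeal.primeCompl
      (X'.presheaf.stalk x')
  have hC : stalkIdeal (strictTransformIdeal τ J K ⊔ J.comap τ) x' =
      Ideal.span {χ (MvPolynomial.aeval (blowupAlgebra.frac c j) Φ)} ⊔
        Ideal.span {χ (algebraMap _ (blowupAlgebra (Ideal.span (Set.range c)) (c j)) (c j))} := by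
    rw [stalkIdeal_sup, hSt, hE]
  refine ⟨hE, hSt, hC, ?_⟩
  have ht𝔔 : algebraMap _ (blowupAlgebra (Ideal.span (Set.range c)) (c j)) (c j) ∈ 𝔔.asIdeal := by
    rw [← Ideal.mem_comap, h𝔔]
    have h := (mem_support_iff_stalkIdeal_le J (τ x')).mp hpJ
    rw [← hcJ] at h
    exact h (Ideal.subset_span (Set.mem_range_self j))
  have hmem : ∀ b, χ b ∈ maximalIdeal (X'.presheaf.stalk x') ↔ b ∈ 𝔔.asIdeal := fun b =>
    IsLocalization.AtPrime.to_map_mem_maximal_iff (X'.presheaf.stalk x') 𝔔.asIdeal b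
  rw [mem_support_iff_stalkIdeal_le, hC, sup_le_iff, Ideal.span_singleton_le_iff_mem, Ideal.span_singleton_le_iff_mem,
    hmem, hmem]
  exact ⟨fun h => h.1, fun h => ⟨h, ht𝔔⟩⟩

set_option maxHeartbeats 400000 in -- the chart algebra `blowupAlgebra` is a subalgebra of a localisation: slow instance unification (cf. p513634)
/-- **F3b at the point on a GIVEN chart presentation, with the Δ-criterion on that chart only.** In the setting of
`stalkIdeal_carrierDelta_of_presentation`, with `ϖ_R ∈ 𝔪_R` the germ of a global section `v`, `θ : R/(c) ≅ Λ`, and `x'` a point of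
`C = St_τ(K) ⊔ J·𝒪_{X'}`: IF every localisation of `Λ[T_l : l ≠ j]/(Φ̄_j^θ)` at a prime containing `C(θ ϖ̄_R)` is regular — the chart-`j`
clause of T-ΔLIFT(-CENTRED) — THEN `𝒪_{X',x'}/C_{x'}` is a regular local ring. [cite: Matsumura1987, Thm. 14.2] -/
theorem isRegularLocalRing_stalk_quotient_carrierDelta_of_presentation [IsLocallyNoetherian X']
    (K : X.IdealSheafData) (x' : X') (p : X) (hp : τ x' = p) (hpJ : p ∈ (J.support : Set X)) {r : ℕ}
    (c : Fin r → X.presheaf.stalk p) (hcJ : Ideal.span (Set.range c) = stalkIdeal J p)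
    (hc : IsQuasiRegular c) [IsDomain (X.presheaf.stalk p ⧸ Ideal.span (Set.range c))]
    {d : ℕ} (Φ : MvPolynomial (Fin r) (X.presheaf.stalk p)) (hΦd : Φ.IsHomogeneous d)
    (hΦ : MvPolynomial.map (Ideal.Quotient.mk (Ideal.span (Set.range c))) Φ ≠ 0)
    (hK : stalkIdeal K p = Ideal.span {MvPolynomial.eval c Φ}) (v : Γ(X, ⊤))
    (hϖ𝔪 : (X.presheaf.Γgerm p).hom v ∈ maximalIdeal (X.presheaf.stalk p))
    {Λ : Type u} [CommRing Λ] (θ : (X.presheaf.stalk p ⧸ Ideal.span (Set.range c)) ≃+* Λ)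
    (j : Fin r) (𝔔 : PrimeSpectrum (blowupAlgebra (Ideal.span (Set.range c)) (c j)))
    (χ : blowupAlgebra (Ideal.span (Set.range c)) (c j) →+* X'.presheaf.stalk x')
    (hχ : ∀ a, χ (algebraMap _ _ a) = ((X.presheaf.stalkCongr (Inseparable.of_eq hp)).inv ≫ τ.stalkMap x').hom a)
    (hloc : @IsLocalization.AtPrime _ _ (X'.presheaf.stalk x') _ χ.toAlgebra 𝔔.asIdeal _)
    (h𝔔 : 𝔔.asIdeal.comap (algebraMap _ (blowupAlgebra (Ideal.span (Set.range c)) (c j))) = maximalIdeal (X.presheaf.stalk p))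
    (hreg : ∀ (𝔓 : Ideal (MvPolynomial {l : Fin r // l ≠ j} Λ ⧸ Ideal.span {MvPolynomial.map
        (θ.toRingHom.comp (Ideal.Quotient.mk (Ideal.span (Set.range c)))) (dehomogenize j Φ)})) [𝔓.IsPrime],
      Ideal.Quotient.mk _ (MvPolynomial.C (θ (Ideal.Quotient.mk _ ((X.presheaf.Γgerm p).hom v)))) ∈ 𝔓 →
        IsRegularLocalRing (Localization.AtPrime 𝔓))
    (hx' : x' ∈ (strictTransformIdeal τ J K ⊔ J.comap τ).support) :
    IsRegularLocalRing (X'.presheaf.stalk x' ⧸ stalkIdeal (strictTransformIdeal τ J K ⊔ J.comap τ) x') := by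
  -- adapted from `isRegularLocalRing_stalk_quotient_carrierDelta` (…NatCarrierDeltaRegular, res-type-100): the presentation is an input
  obtain ⟨-, -, hC, hiff⟩ := stalkIdeal_carrierDelta_of_presentation K x' p hp hpJ c hcJ hc Φ hΦd hΦ hK j 𝔔 χ hχ hloc h𝔔
  subst hp
  letI := χ.toAlgebra
  haveI : IsLocalization.AtPrime (X'.presheaf.stalk x') 𝔔.asIdeal := hloc
  have hG'𝔔 : MvPolynomial.aeval (blowupAlgebra.frac c j) Φ ∈ 𝔔.asIdeal := hiff.mp hx'
  have ht𝔔 : algebraMap _ (blowupAlgebra (Ideal.span (Set.range c)) (c j)) (c j) ∈ 𝔔.asIdeal := by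
    rw [← Ideal.mem_comap, h𝔔]
    have h := (mem_support_iff_stalkIdeal_le J (τ x')).mp hpJ
    rw [← hcJ] at h
    exact h (Ideal.subset_span (Set.mem_range_self j))
  have h𝔞𝔔 : Ideal.span {MvPolynomial.aeval (blowupAlgebra.frac c j) Φ} ⊔
      Ideal.span {algebraMap _ (blowupAlgebra (Ideal.span (Set.range c)) (c j)) (c j)} ≤ 𝔔.asIdeal :=
    sup_le ((Ideal.span_singleton_le_iff_mem _).mpr hG'𝔔) ((Ideal.span_singleton_le_iff_mem _).mpr ht𝔔)
  have hϖ𝔔 : algebraMap _ (blowupAlgebra (Ideal.span (Set.range c)) (c j)) ((X.presheaf.Γgerm (τ x')).hom v) ∈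
      𝔔.asIdeal := by
    rw [← Ideal.mem_comap, h𝔔]; exact hϖ𝔪
  have hCmap : stalkIdeal (strictTransformIdeal τ J K ⊔ J.comap τ) x' =
      (Ideal.span {MvPolynomial.aeval (blowupAlgebra.frac c j) Φ} ⊔
        Ideal.span {algebraMap _ (blowupAlgebra (Ideal.span (Set.range c)) (c j)) (c j)}).map
        (algebraMap (blowupAlgebra (Ideal.span (Set.range c)) (c j)) (X'.presheaf.stalk x')) := by
    rw [hC, Ideal.map_sup, Ideal.map_span, Ideal.map_span, Set.image_singleton, Set.image_singleton]
    rfl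
  haveI : (𝔔.asIdeal.map (Ideal.Quotient.mk (Ideal.span {MvPolynomial.aeval (blowupAlgebra.frac c j) Φ} ⊔
      Ideal.span {algebraMap _ (blowupAlgebra (Ideal.span (Set.range c)) (c j)) (c j)}))).IsPrime :=
    Ideal.map_isPrime_of_surjective Ideal.Quotient.mk_surjective (by rw [Ideal.mk_ker]; exact h𝔞𝔔)
  obtain ⟨ε₀, hε₀a, -⟩ := exists_quotient_coneTransform_sup_equiv c j hc Φ
  have hreg' := isRegularLocalRing_localization_map_of_deltaCriterion c j Φ _ θ hreg _ _ ε₀ (hε₀a _) 𝔔.asIdeal hϖ𝔔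
  have hS := isRegularLocalRing_quotient_map_of_isLocalization (S := X'.presheaf.stalk x') 𝔔.asIdeal _ h𝔞𝔔 hreg'
  rw [← hCmap] at hS
  exact hS

end Summit.ResolutionOfSingularities.ResolutionOfSingularities.Cruxes.EquisingularLiftNat.Sections

end
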